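import Summits.BirchSwinnertonDyer.Rank1Residual.X1.GeneratorCountAnomalousTwo
import HarnessLib

/-!
# Route M's generator COUNT, IV: the leaf consumers with counts `#S + 1` and `#S + 2` — route M's
# closures on X1 ∩ {r = 0} with the generator count DISCHARGED modulo one local hypothesis at `p`
# (cell `b2b-bsdres`, unit `b2b-bsdres-eisenstein-p1`, gen 15; FILE 4, imports FILES 3 and 5)

HONEST FRAMING (run/shared/lean/b2b/bsd-rank1-residual/, verbatim in every file): the goal of the
cell is to DELETE the COMBINATION-SHAPED residual classes of the Birch–Swinnerton-Dyer formula for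
ALL analytic-rank `≤ 1` elliptic curves over `ℚ` — "full BSD formula for every rank `≤ 1` curve in
class `C`" assembled STRICTLY from published theorems — so that the rank-`≤ 1` remainder becomes
exactly the CONSTRUCTION-SHAPED classes, which are TYPED (missing-input `Prop`s), NOT attempted.
This is not "finishing BSD". Sub-cell `b2b-bsdres-eisenstein-p1` (CLASS-OWNERS row "X1 (r = 0)"):
research route; NO CLAIM BEYOND STATED CLASSES; nothing here changes a label; nothing is booked.
THEOREMS ONLY; named PUBLISHED facts as in `X1/GeneratorCountSqueezeFacts.lean` (Wuthrich 2014
Thm. 16, Greenberg 1999 Thm. 4.1 / Prop. 3.10 / Prop. 4.15 (ii), modularity, Gross–Zagier–Kolyvagin)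
plus Poitou–Tate duality for Selmer structures over `ℚ`; the local hypothesis `hloc` of FILE 3 §1
(every class of `H¹(ℚ, E[p])` satisfies the `ℚ_∞`-local condition at `p`: true on the leaf, where
every `p` is anomalous; to be discharged); typed per-pair inputs `AnalyticMuLE` / `MuPartAt`,
`AnalyticLambdaEq`, `AnalyticLamConstValDivisorSet`.

What: `X1/GeneratorCountSqueezeFacts.lean`'s three leaf theorems with the typed count
`GeneratorCountGE W p B` replaced by FILE 3's theorem `generatorCountGE_of_dvd_localTamagawaNumber_atP`
(`B = #S + 1`, `S` = places `v ∤ p` with `p ∣ c_v`, member with `p ∤ #E(ℚ)_tors`):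
`Leaf.bsdp_of_muZero_of_tamagawaCountAtP` (`μ = 0` member), `…_inter` (M₀ ∘ C shape),
`Leaf.bsdp_of_muPartAt_of_tamagawaCountAtP` (`μ ≥ 1` member); and by FILE 5's
`generatorCountGE_of_dvd_localTamagawaNumber_atP_two` (`B = #S + 2`, given a point of order `p` in
`E(ℚ_p)` — the `μ = 0` member `E₀` of a `φ ≠ 1` class carries the even unramified line `Φ ⊂ E₀(ℚ_p)`):
`Leaf.bsdp_of_muZero_of_tamagawaCountAtP_two`, `…_two_inter`, `Leaf.bsdp_of_muPartAt_of_tamagawaCountAtP_two`.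
Census reach (X1R0-GAPMAP §24): 69/482 M₀-type closures at count `t₀ + 1`, 177/482 at `t₀ + a`.

References: [GreenbergLNM1716] Prop. 3.10, Lemma 3.4, Thm. 4.1, §5 pp. 114–118, p. 137;
[Wuthrich2014] Thm. 16; X1R0-GAPMAP §14.1, §22, §24.
-/

noncomputable section

open scoped Classical

open Function Field NumberField IsDedekindDomain WeierstrassCurve
  Literature.NumberTheory.EllipticCurves Literature.NumberTheory.GaloisRepresentations
  Literature.NumberTheory.GaloisCohomology Summit.BirchSwinnertonDyer.Rank1Residual.GaloisImage
  Summit.BirchSwinnertonDyer.Rank1Residual.X1.GeneratorCountAnomalous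
  Summit.BirchSwinnertonDyer.Rank1Residual.X1.GeneratorCountAnomalousTwo

set_option autoImplicit false

namespace Summit.BirchSwinnertonDyer.Rank1Residual.X1.GeneratorCountAnomalousLeaf

variable {W : WeierstrassCurve ℚ} [W.IsElliptic] {p : ℕ} [hp : Fact p.Prime]

/-! ## §4. On the leaf X1 ∩ {r = 0}: route M's closures with the count `#S + 1` -/

section Leaf

open Literature.NumberTheory.EllipticCurves.Rank1Residual
  Literature.NumberTheory.EllipticCurves.ModularForms
  Literature.NumberTheory.EllipticCurves.Greenberg1999
  Summit.BirchSwinnertonDyer.BirchSwinnertonDyer.Theorems.Rank1ResidualX1Defs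
  Summit.BirchSwinnertonDyer.Rank1Residual.X1.MuLambda
  Summit.BirchSwinnertonDyer.Rank1Residual.X1.MuPart
  Summit.BirchSwinnertonDyer.Rank1Residual.X1.ParitySqueeze
  Summit.BirchSwinnertonDyer.Rank1Residual.X1.TamagawaSqueeze
  Summit.BirchSwinnertonDyer.Rank1Residual.X1.FactorSqueeze
  Summit.BirchSwinnertonDyer.Rank1Residual.X1.GeneratorSqueeze
  Summit.BirchSwinnertonDyer.Rank1Residual.X1.GeneratorCountSqueeze
  Summit.BirchSwinnertonDyer.Rank1Residual.X1.GeneratorCountSqueezeFacts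

variable [W.IsGloballyMinimal]

/-- **ROUTE M at the `μ = 0` member, count `#S + 1`, `p ∤ #E(ℚ)_tors`:** `μ_an = 0 ∧ λ_an = n ∧
(p ∣ c_v on S) ∧ hloc ∧ (Newton data S') ∧ gap ⇒ BSD(E,p)` on the leaf. Named
PUBLISHED facts: Wuthrich 2014 Thm. 16, Greenberg 1999 Thm. 4.1 / Prop. 3.10 / Prop. 4.15 (ii),
modularity, Gross–Zagier–Kolyvagin, Poitou–Tate duality over `ℚ`. Hypothesis `hloc` (FILE 3 §1; true
on the leaf: every `p` there is anomalous); typed `AnalyticMuLE`, `AnalyticLambdaEq`,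
`AnalyticLamConstValDivisorSet`. [cite: GreenbergLNM1716, Prop. 3.10, Lemma 3.4, Thm. 4.1, §5 pp. 114–118, p. 137]
[cite: Wuthrich2014, Thm. 16 (p. 397)] -/
theorem Leaf.bsdp_of_muZero_of_tamagawaCountAtP
    (hW16 : Wuthrich2014.charIdeal_dvd_padicLFunction) (hGr : greenberg_charValue_rankZero)
    (h310 : prop310_selmerCorank_mod_two_eq_lambdaInvariant)
    (h415 : prop415ii_noFiniteSubmodule_of_ordinary_or_multiplicative)
    (hmod : nonempty_modularParametrizationData)
    (hGZK : rank_eq_analyticRank_of_analyticRank_le_one)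
    (hPT : poitouTate_selmerStructure_duality ℚ)
    (hL : RankZero.Leaf W p) (htors : ¬ p ∣ W.torsionOrder) (hloc : ∀ (κ : ZpExtension ℚ p), κ.IsCyclotomic → ∀ (v : HeightOneSpectrum (𝓞 ℚ)),
      ((p : ℕ) : 𝓞 ℚ) ∈ v.asIdeal → ∀ y : galH1Torsion W (p : ℤ),
      W.layerToInfty κ 0 (resH1Hom (Literature.NumberTheory.EllipticCurves.subgroupIncl (κ.layerSubgroup 0))
          (AddMonoidHom.id (geomPrimaryTorsion W p)) (fun _ _ ↦ rfl) (torsionToPrimaryH1 W p y)) ∈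
        W.localKerOver p κ.kerSubgroup (v.adicCompletion ℚ))
    (hμ0 : AnalyticMuLE W p 0) {n : ℕ} {S' : Set (ℕ × ℕ)} (hlam : AnalyticLambdaEq W p n)
    (S : Finset (HeightOneSpectrum (𝓞 ℚ))) (hSp : ∀ v ∈ S, ((p : ℕ) : 𝓞 ℚ) ∉ v.asIdeal)
    (hcv : ∀ v ∈ S,
      p ∣ (W.baseChange (v.adicCompletion ℚ)).localTamagawaNumber (v.adicCompletionIntegers ℚ))
    (vp : HeightOneSpectrum (𝓞 ℚ)) (hvp : ((p : ℕ) : 𝓞 ℚ) ∈ vp.asIdeal)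
    (hS : AnalyticLamConstValDivisorSet W p S')
    (hgap : ∀ d v, (d, v) ∈ S' → S.card + 1 ≤ v → Even d → d ≤ n → n ≤ d + 1) : BSDp W p :=
  Leaf.bsdp_of_muZero_of_generatorCount_of_prop415 hW16 hGr h310 h415 hmod hGZK hL hμ0 hlam
    (generatorCountGE_of_dvd_localTamagawaNumber_atP (isClassX1_of_classX1 hL.classX1).two_ne hPT
      htors hloc S hSp hcv vp hvp) hS hgap

/-- **The same intersected with a second membership certificate** (M₀ ∘ C shape), count `#S + 1`.
[cite: GreenbergLNM1716, Prop. 3.10, Thm. 4.1, §5 pp. 114–118, pp. 132, 137] [cite: Wuthrich2014, Thm. 16 (p. 397)] -/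
theorem Leaf.bsdp_of_muZero_of_tamagawaCountAtP_inter
    (hW16 : Wuthrich2014.charIdeal_dvd_padicLFunction) (hGr : greenberg_charValue_rankZero)
    (h310 : prop310_selmerCorank_mod_two_eq_lambdaInvariant)
    (h415 : prop415ii_noFiniteSubmodule_of_ordinary_or_multiplicative)
    (hmod : nonempty_modularParametrizationData)
    (hGZK : rank_eq_analyticRank_of_analyticRank_le_one)
    (hPT : poitouTate_selmerStructure_duality ℚ)
    (hL : RankZero.Leaf W p) (htors : ¬ p ∣ W.torsionOrder) (hloc : ∀ (κ : ZpExtension ℚ p), κ.IsCyclotomic → ∀ (v : HeightOneSpectrum (𝓞 ℚ)),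
      ((p : ℕ) : 𝓞 ℚ) ∈ v.asIdeal → ∀ y : galH1Torsion W (p : ℤ),
      W.layerToInfty κ 0 (resH1Hom (Literature.NumberTheory.EllipticCurves.subgroupIncl (κ.layerSubgroup 0))
          (AddMonoidHom.id (geomPrimaryTorsion W p)) (fun _ _ ↦ rfl) (torsionToPrimaryH1 W p y)) ∈
        W.localKerOver p κ.kerSubgroup (v.adicCompletion ℚ))
    (hμ0 : AnalyticMuLE W p 0) {n : ℕ} {S' : Set (ℕ × ℕ)} {A' : Set ℕ}
    (hlam : AnalyticLambdaEq W p n) (S : Finset (HeightOneSpectrum (𝓞 ℚ)))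
    (hSp : ∀ v ∈ S, ((p : ℕ) : 𝓞 ℚ) ∉ v.asIdeal)
    (hcv : ∀ v ∈ S,
      p ∣ (W.baseChange (v.adicCompletion ℚ)).localTamagawaNumber (v.adicCompletionIntegers ℚ))
    (vp : HeightOneSpectrum (𝓞 ℚ)) (hvp : ((p : ℕ) : 𝓞 ℚ) ∈ vp.asIdeal)
    (hS : AnalyticLamConstValDivisorSet W p S') (hA' : AlgebraicLambdaMem W p A')
    (hgap : ∀ d v, (d, v) ∈ S' → S.card + 1 ≤ v → d ∈ A' → Even d → d ≤ n → n ≤ d + 1) :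
    BSDp W p :=
  Leaf.bsdp_of_muZero_of_generatorCount_inter_of_prop415 hW16 hGr h310 h415 hmod hGZK hL hμ0 hlam
    (generatorCountGE_of_dvd_localTamagawaNumber_atP (isClassX1_of_classX1 hL.classX1).two_ne hPT
      htors hloc S hSp hcv vp hvp) hS hA' hgap

/-- **ROUTE M at a `μ ≥ 1` member with `p ∤ #E(ℚ)_tors`, count `#S + 1`** (μ-part `MuPartAt W p`
from route P / `X1/MuPart.lean`). [cite: GreenbergLNM1716, Prop. 3.10, Thm. 4.1, §5 pp. 114–118, p. 137]
[cite: Wuthrich2014, Thm. 16 (p. 397)] -/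
theorem Leaf.bsdp_of_muPartAt_of_tamagawaCountAtP
    (hW16 : Wuthrich2014.charIdeal_dvd_padicLFunction) (hGr : greenberg_charValue_rankZero)
    (h310 : prop310_selmerCorank_mod_two_eq_lambdaInvariant)
    (h415 : prop415ii_noFiniteSubmodule_of_ordinary_or_multiplicative)
    (hmod : nonempty_modularParametrizationData)
    (hGZK : rank_eq_analyticRank_of_analyticRank_le_one)
    (hPT : poitouTate_selmerStructure_duality ℚ)
    (hL : RankZero.Leaf W p) (htors : ¬ p ∣ W.torsionOrder) (hloc : ∀ (κ : ZpExtension ℚ p), κ.IsCyclotomic → ∀ (v : HeightOneSpectrum (𝓞 ℚ)),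
      ((p : ℕ) : 𝓞 ℚ) ∈ v.asIdeal → ∀ y : galH1Torsion W (p : ℤ),
      W.layerToInfty κ 0 (resH1Hom (Literature.NumberTheory.EllipticCurves.subgroupIncl (κ.layerSubgroup 0))
          (AddMonoidHom.id (geomPrimaryTorsion W p)) (fun _ _ ↦ rfl) (torsionToPrimaryH1 W p y)) ∈
        W.localKerOver p κ.kerSubgroup (v.adicCompletion ℚ))
    (hμ : MuPartAt W p) {n : ℕ} {S' : Set (ℕ × ℕ)} (hlam : AnalyticLambdaEq W p n)
    (S : Finset (HeightOneSpectrum (𝓞 ℚ))) (hSp : ∀ v ∈ S, ((p : ℕ) : 𝓞 ℚ) ∉ v.asIdeal)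
    (hcv : ∀ v ∈ S,
      p ∣ (W.baseChange (v.adicCompletion ℚ)).localTamagawaNumber (v.adicCompletionIntegers ℚ))
    (vp : HeightOneSpectrum (𝓞 ℚ)) (hvp : ((p : ℕ) : 𝓞 ℚ) ∈ vp.asIdeal)
    (hS : AnalyticLamConstValDivisorSet W p S')
    (hgap : ∀ d v, (d, v) ∈ S' → S.card + 1 ≤ v → Even d → d ≤ n → n ≤ d + 1) : BSDp W p :=
  Leaf.bsdp_of_muPartAt_of_generatorCount_of_prop415 hW16 hGr h310 h415 hmod hGZK hL hμ hlam
    (generatorCountGE_of_dvd_localTamagawaNumber_atP (isClassX1_of_classX1 hL.classX1).two_ne hPT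
      htors hloc S hSp hcv vp hvp) hS hgap

/-- **ROUTE M at the `μ = 0` member, count `#S + 2`** (a `ℚ_p`-point of order `p` on `E`, e.g. the
even unramified line `Φ ⊂ E₀(ℚ_p)[p]` of the `μ = 0` member of a `φ ≠ 1` class): `μ_an = 0 ∧ λ_an = n ∧
(p ∣ c_v on S) ∧ hloc ∧ E(ℚ_p)[p] ≠ 0 ∧ (Newton data S') ∧ gap ⇒ BSD(E,p)`.
[cite: GreenbergLNM1716, Prop. 3.10, Lemma 3.4, Thm. 4.1, §5 pp. 114–118, p. 137] [cite: Wuthrich2014, Thm. 16 (p. 397)] -/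
theorem Leaf.bsdp_of_muZero_of_tamagawaCountAtP_two
    (hW16 : Wuthrich2014.charIdeal_dvd_padicLFunction) (hGr : greenberg_charValue_rankZero)
    (h310 : prop310_selmerCorank_mod_two_eq_lambdaInvariant)
    (h415 : prop415ii_noFiniteSubmodule_of_ordinary_or_multiplicative)
    (hmod : nonempty_modularParametrizationData)
    (hGZK : rank_eq_analyticRank_of_analyticRank_le_one)
    (hPT : poitouTate_selmerStructure_duality ℚ)
    (hL : RankZero.Leaf W p) (htors : ¬ p ∣ W.torsionOrder)
    (hloc : ∀ (κ : ZpExtension ℚ p), κ.IsCyclotomic → ∀ (v : HeightOneSpectrum (𝓞 ℚ)),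
      ((p : ℕ) : 𝓞 ℚ) ∈ v.asIdeal → ∀ y : galH1Torsion W (p : ℤ),
      W.layerToInfty κ 0 (resH1Hom (Literature.NumberTheory.EllipticCurves.subgroupIncl (κ.layerSubgroup 0))
          (AddMonoidHom.id (geomPrimaryTorsion W p)) (fun _ _ ↦ rfl) (torsionToPrimaryH1 W p y)) ∈
        W.localKerOver p κ.kerSubgroup (v.adicCompletion ℚ))
    (hμ0 : AnalyticMuLE W p 0) {n : ℕ} {S' : Set (ℕ × ℕ)} (hlam : AnalyticLambdaEq W p n)
    (S : Finset (HeightOneSpectrum (𝓞 ℚ))) (hSp : ∀ v ∈ S, ((p : ℕ) : 𝓞 ℚ) ∉ v.asIdeal)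
    (hcv : ∀ v ∈ S,
      p ∣ (W.baseChange (v.adicCompletion ℚ)).localTamagawaNumber (v.adicCompletionIntegers ℚ))
    (vp : HeightOneSpectrum (𝓞 ℚ)) (hvp : ((p : ℕ) : 𝓞 ℚ) ∈ vp.asIdeal)
    (hPt : ∃ P : (W.baseChange (vp.adicCompletion ℚ)).toAffine.Point, P ≠ 0 ∧ p • P = 0)
    (hS : AnalyticLamConstValDivisorSet W p S')
    (hgap : ∀ d v, (d, v) ∈ S' → S.card + 2 ≤ v → Even d → d ≤ n → n ≤ d + 1) : BSDp W p :=
  Leaf.bsdp_of_muZero_of_generatorCount_of_prop415 hW16 hGr h310 h415 hmod hGZK hL hμ0 hlam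
    (generatorCountGE_of_dvd_localTamagawaNumber_atP_two (isClassX1_of_classX1 hL.classX1).two_ne hPT
      htors hloc S hSp hcv vp hvp hPt) hS hgap

/-- **The same intersected with a second membership certificate** (M₀ ∘ C shape), count `#S + 2`.
[cite: GreenbergLNM1716, Prop. 3.10, Thm. 4.1, §5 pp. 114–118, pp. 132, 137] [cite: Wuthrich2014, Thm. 16 (p. 397)] -/
theorem Leaf.bsdp_of_muZero_of_tamagawaCountAtP_two_inter
    (hW16 : Wuthrich2014.charIdeal_dvd_padicLFunction) (hGr : greenberg_charValue_rankZero)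
    (h310 : prop310_selmerCorank_mod_two_eq_lambdaInvariant)
    (h415 : prop415ii_noFiniteSubmodule_of_ordinary_or_multiplicative)
    (hmod : nonempty_modularParametrizationData)
    (hGZK : rank_eq_analyticRank_of_analyticRank_le_one)
    (hPT : poitouTate_selmerStructure_duality ℚ)
    (hL : RankZero.Leaf W p) (htors : ¬ p ∣ W.torsionOrder)
    (hloc : ∀ (κ : ZpExtension ℚ p), κ.IsCyclotomic → ∀ (v : HeightOneSpectrum (𝓞 ℚ)),
      ((p : ℕ) : 𝓞 ℚ) ∈ v.asIdeal → ∀ y : galH1Torsion W (p : ℤ),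
      W.layerToInfty κ 0 (resH1Hom (Literature.NumberTheory.EllipticCurves.subgroupIncl (κ.layerSubgroup 0))
          (AddMonoidHom.id (geomPrimaryTorsion W p)) (fun _ _ ↦ rfl) (torsionToPrimaryH1 W p y)) ∈
        W.localKerOver p κ.kerSubgroup (v.adicCompletion ℚ))
    (hμ0 : AnalyticMuLE W p 0) {n : ℕ} {S' : Set (ℕ × ℕ)} {A' : Set ℕ}
    (hlam : AnalyticLambdaEq W p n) (S : Finset (HeightOneSpectrum (𝓞 ℚ)))
    (hSp : ∀ v ∈ S, ((p : ℕ) : 𝓞 ℚ) ∉ v.asIdeal)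
    (hcv : ∀ v ∈ S,
      p ∣ (W.baseChange (v.adicCompletion ℚ)).localTamagawaNumber (v.adicCompletionIntegers ℚ))
    (vp : HeightOneSpectrum (𝓞 ℚ)) (hvp : ((p : ℕ) : 𝓞 ℚ) ∈ vp.asIdeal)
    (hPt : ∃ P : (W.baseChange (vp.adicCompletion ℚ)).toAffine.Point, P ≠ 0 ∧ p • P = 0)
    (hS : AnalyticLamConstValDivisorSet W p S') (hA' : AlgebraicLambdaMem W p A')
    (hgap : ∀ d v, (d, v) ∈ S' → S.card + 2 ≤ v → d ∈ A' → Even d → d ≤ n → n ≤ d + 1) :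
    BSDp W p :=
  Leaf.bsdp_of_muZero_of_generatorCount_inter_of_prop415 hW16 hGr h310 h415 hmod hGZK hL hμ0 hlam
    (generatorCountGE_of_dvd_localTamagawaNumber_atP_two (isClassX1_of_classX1 hL.classX1).two_ne hPT
      htors hloc S hSp hcv vp hvp hPt) hS hA' hgap

/-- **ROUTE M at a `μ ≥ 1` member with `p ∤ #E(ℚ)_tors` and a `ℚ_p`-point of order `p`, count
`#S + 2`** (μ-part `MuPartAt W p`). [cite: GreenbergLNM1716, Prop. 3.10, Lemma 3.4, Thm. 4.1, §5 pp. 114–118, p. 137]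
[cite: Wuthrich2014, Thm. 16 (p. 397)] -/
theorem Leaf.bsdp_of_muPartAt_of_tamagawaCountAtP_two
    (hW16 : Wuthrich2014.charIdeal_dvd_padicLFunction) (hGr : greenberg_charValue_rankZero)
    (h310 : prop310_selmerCorank_mod_two_eq_lambdaInvariant)
    (h415 : prop415ii_noFiniteSubmodule_of_ordinary_or_multiplicative)
    (hmod : nonempty_modularParametrizationData)
    (hGZK : rank_eq_analyticRank_of_analyticRank_le_one)
    (hPT : poitouTate_selmerStructure_duality ℚ)
    (hL : RankZero.Leaf W p) (htors : ¬ p ∣ W.torsionOrder)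
    (hloc : ∀ (κ : ZpExtension ℚ p), κ.IsCyclotomic → ∀ (v : HeightOneSpectrum (𝓞 ℚ)),
      ((p : ℕ) : 𝓞 ℚ) ∈ v.asIdeal → ∀ y : galH1Torsion W (p : ℤ),
      W.layerToInfty κ 0 (resH1Hom (Literature.NumberTheory.EllipticCurves.subgroupIncl (κ.layerSubgroup 0))
          (AddMonoidHom.id (geomPrimaryTorsion W p)) (fun _ _ ↦ rfl) (torsionToPrimaryH1 W p y)) ∈
        W.localKerOver p κ.kerSubgroup (v.adicCompletion ℚ))
    (hμ : MuPartAt W p) {n : ℕ} {S' : Set (ℕ × ℕ)} (hlam : AnalyticLambdaEq W p n)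
    (S : Finset (HeightOneSpectrum (𝓞 ℚ))) (hSp : ∀ v ∈ S, ((p : ℕ) : 𝓞 ℚ) ∉ v.asIdeal)
    (hcv : ∀ v ∈ S,
      p ∣ (W.baseChange (v.adicCompletion ℚ)).localTamagawaNumber (v.adicCompletionIntegers ℚ))
    (vp : HeightOneSpectrum (𝓞 ℚ)) (hvp : ((p : ℕ) : 𝓞 ℚ) ∈ vp.asIdeal)
    (hPt : ∃ P : (W.baseChange (vp.adicCompletion ℚ)).toAffine.Point, P ≠ 0 ∧ p • P = 0)
    (hS : AnalyticLamConstValDivisorSet W p S')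
    (hgap : ∀ d v, (d, v) ∈ S' → S.card + 2 ≤ v → Even d → d ≤ n → n ≤ d + 1) : BSDp W p :=
  Leaf.bsdp_of_muPartAt_of_generatorCount_of_prop415 hW16 hGr h310 h415 hmod hGZK hL hμ hlam
    (generatorCountGE_of_dvd_localTamagawaNumber_atP_two (isClassX1_of_classX1 hL.classX1).two_ne hPT
      htors hloc S hSp hcv vp hvp hPt) hS hgap


end Leaf

end Summit.BirchSwinnertonDyer.Rank1Residual.X1.GeneratorCountAnomalousLeaf

end
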